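import Literature.Barriers.QuantumAdvantage.AaronsonChenProtocol
import Literature.Computability.Complexity.AdaptiveFunctions
import HarnessLib

/-!
# Aaronson–Chen 2017, Lemma 5.3: correctness of the simulator's protocol along the true history

Continuation of `AaronsonChenProtocol.lean` (the protocol of the `SampBPP^{TQBF,O}` machine `A` of
Aaronson–Chen 2017, Lemma 5.3 [AaronsonChen2017, §5.3 pp. 22–23]: advice queries to a language
`ADV` spelling the strings to query, the sample and the output; `O`-queries after every advice bit).
Here the adaptive run of the query generator `qSem ρ` against `TQBF ⊕ O` is identified, for any `ρ`
reducing `ADV` to `TQBF` (`∀ z, z ∈ advLang ↔ ρ z ∈ TQBF`):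

* `hist` — the TRUE HISTORY: advice bits of the stream with the true tables at even rounds, the
  `O`-answers `oAns` (membership in `O` of the string spelled by the last `W` advice bits) at odd
  rounds; `evens_hist`, `blockOf_hist`, `getD_hist_slot_end`;
* **`tabsOf_hist_eq`** (the crux): along the true history, once all slots of the stages `≤ u` are
  complete, the tables read off the history ARE the true tables `O ∩ K_u` — the complete real
  positively-answered blocks decode exactly to the strings of `O` queried so far ("we use a
  function `f_known` to encode our knowledge", p. 22);
* `advBit_hist` — hence the advice bit answered along the true history is the bit of the advice
  stream with the true tables; **`adBits_qSem_eq_hist`** — the answer bits of the adaptive run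
  (`AdQuery.adBits`, `Complexity/AdaptiveQueries.lean`) are the true history;
* **`adFn_qSem_gSem`** — the transducer `(qSem ρ, roundsP, gSem)` outputs `post(y)` on `⟨x₀, r⟩`
  against `TQBF ⊕ O`, and **`ySample_trueTabs`** — `y` is the inverse-CDF sample, in numeral order,
  of the Born law of the final state `V|x₀, 0^m⟩` (`acSimState`) against the coins `r` ("it first
  takes a sample `z` by measuring `|v_{T+1}⟩` … and then outputs `A^output(z)`", p. 23).

The machine (`FP` bricks for `qSem`, `gSem`; the PPT adversary; the total-variation bound and the
assembly of `aaronsonChen2017_lem53_machine`) is `AaronsonChenMachine.lean`.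

## References

* [AaronsonChen2017] arXiv:1612.05903, §5.3 (pp. 22–23), read via `lit read arxiv:1612.05903 --pages 19-25`.
-/

noncomputable section

namespace Literature.Barriers.QuantumAdvantage

open MeasureTheory _root_.Computability Polynomial Literature.Computability.Complexity
  Literature.Computability.Cryptography Literature.Computability.QuantumComplexity

namespace AcProto

variable (P : AcProto)

/-! ### The true history of answers and the correctness of the protocol -/

/-- **The `O`-answer received after advice bit `e`** in the true run: the membership in `O` of the
string spelled by the last `W` advice bits. [cite: AaronsonChen2017, §5.3 (p. 22, "query all x ∈ {0,1}^{2n} with Q(x) ≥ τ")] -/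
def oAns (O : Set (List Bool)) (x₀ r : List Bool) (e : ℕ) : Bool :=
  O.boolIndicator (decodePad (lastN (P.Wd (wl x₀ r)) ((P.advStream x₀ r (P.trueTabs O x₀)).take (e + 1))))

/-- Bit `t` of the true history: an advice bit (of the stream with the true tables) at even `t`,
an `O`-answer at odd `t`. [folklore] -/
def histBit (O : Set (List Bool)) (x₀ r : List Bool) (t : ℕ) : Bool :=
  if t % 2 = 0 then P.advAt x₀ r (P.trueTabs O x₀) (t / 2) else P.oAns O x₀ r (t / 2)

/-- **The true history** of the first `i` answers of the protocol against `TQBF ⊕ O`. [folklore] -/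
def hist (O : Set (List Bool)) (x₀ r : List Bool) (i : ℕ) : List Bool :=
  (List.range i).map (P.histBit O x₀ r)

/-- The true history of `i` answers has length `i`. [folklore] -/
@[simp] theorem length_hist (O : Set (List Bool)) (x₀ r : List Bool) (i : ℕ) : (P.hist O x₀ r i).length = i := by
  simp [hist]

/-- One more answer. [folklore] -/
theorem hist_succ (O : Set (List Bool)) (x₀ r : List Bool) (i : ℕ) :
    P.hist O x₀ r (i + 1) = P.hist O x₀ r i ++ [P.histBit O x₀ r i] := by
  simp [hist, List.range_succ]

/-- Reading a bit of the true history. [folklore] -/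
theorem getD_hist (O : Set (List Bool)) (x₀ r : List Bool) {i t : ℕ} (ht : t < i) :
    (P.hist O x₀ r i).getD t false = P.histBit O x₀ r t := by
  rw [List.getD_eq_getElem?_getD, hist, List.getElem?_map, List.getElem?_range ht]
  rfl

/-- **The advice answers of the true history are a prefix of the advice stream** (with the true
tables). [folklore] -/
theorem evens_hist (O : Set (List Bool)) (x₀ r : List Bool) {i : ℕ} (hi : (i + 1) / 2 ≤ P.advLen (wl x₀ r)) :
    evens (P.hist O x₀ r i) = (P.advStream x₀ r (P.trueTabs O x₀)).take ((i + 1) / 2) := by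
  rw [hist, evens_map_range, P.take_advStream x₀ r _ hi]
  refine List.map_congr_left fun e _ => ?_
  simp [histBit]

/-- The block read off the true history at a complete slot is the block of the advice stream. [folklore] -/
theorem blockOf_hist (O : Set (List Bool)) (x₀ r : List Bool) {n s j : ℕ} (hn : n < P.Gm (wl x₀ r))
    (hs : s < P.Sm (wl x₀ r)) (hcomp : (n * P.Sm (wl x₀ r) + s + 1) * P.Wd (wl x₀ r) ≤ j)
    (hj : j ≤ P.advLen (wl x₀ r)) :
    P.blockOf x₀ r (P.hist O x₀ r (2 * j)) n s = P.block x₀ r (P.trueTabs O x₀) n s := by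
  unfold blockOf
  have e : (n * P.Sm (wl x₀ r) + s + 1) * P.Wd (wl x₀ r) =
      (n * P.Sm (wl x₀ r) + s) * P.Wd (wl x₀ r) + P.Wd (wl x₀ r) := by ring
  rw [P.evens_hist O x₀ r (i := 2 * j) (by omega), show (2 * j + 1) / 2 = j by omega, List.drop_take,
    List.take_take, min_eq_left (by omega)]
  exact P.drop_take_advStream_eq_block x₀ r _ hn hs

/-- The `O`-answer recorded in the true history after a complete slot is the membership in `O` of
the string the slot spells. [folklore] -/
theorem getD_hist_slot_end (O : Set (List Bool)) (x₀ r : List Bool) {n s j : ℕ} (hn : n < P.Gm (wl x₀ r))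
    (hs : s < P.Sm (wl x₀ r)) (hcomp : (n * P.Sm (wl x₀ r) + s + 1) * P.Wd (wl x₀ r) ≤ j) :
    (P.hist O x₀ r (2 * j)).getD (2 * ((n * P.Sm (wl x₀ r) + s + 1) * P.Wd (wl x₀ r)) - 1) false =
      O.boolIndicator (decodePad (P.block x₀ r (P.trueTabs O x₀) n s)) := by
  have hW : 0 < P.Wd (wl x₀ r) := by unfold Wd; omega
  have hpos : 0 < (n * P.Sm (wl x₀ r) + s + 1) * P.Wd (wl x₀ r) := Nat.mul_pos (by omega) hW
  rw [P.getD_hist O x₀ r (by omega)]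
  unfold histBit oAns
  rw [if_neg (by omega), show (2 * ((n * P.Sm (wl x₀ r) + s + 1) * P.Wd (wl x₀ r)) - 1) / 2 + 1 =
    (n * P.Sm (wl x₀ r) + s + 1) * P.Wd (wl x₀ r) by omega, P.lastN_take_advStream_eq_block x₀ r _ hn hs]

/-- **The crux: the tables read off the true history are the true tables** — for every stage `u`
all of whose slots have been completed (`(u + 1) S W ≤ j` advice bits received), the complete,
real, positively answered blocks of the stages `≤ u` decode exactly to `O ∩ K_u`.
[cite: AaronsonChen2017, §5.3 (p. 22, "we use a function f_known to encode our knowledge")] -/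
theorem tabsOf_hist_eq (hP : P.IsBounded) (O : Set (List Bool)) (x₀ r : List Bool) {u j : ℕ}
    (hu : u < P.Gm (wl x₀ r)) (huj : (u + 1) * (P.Sm (wl x₀ r) * P.Wd (wl x₀ r)) ≤ j) (hj : j ≤ P.advLen (wl x₀ r)) :
    P.tabsOf x₀ r (P.hist O x₀ r (2 * j)) u = P.trueTabs O x₀ u := by
  have hW : 0 < P.Wd (wl x₀ r) := by unfold Wd; omega
  -- completeness of every slot of the stages `≤ u`
  have hcomp : ∀ {n s : ℕ}, n ≤ u → s < P.Sm (wl x₀ r) → (n * P.Sm (wl x₀ r) + s + 1) * P.Wd (wl x₀ r) ≤ j := by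
    intro n s hn hs
    have h1 : n * P.Sm (wl x₀ r) + s + 1 ≤ (u + 1) * P.Sm (wl x₀ r) := by
      have : n * P.Sm (wl x₀ r) ≤ u * P.Sm (wl x₀ r) := Nat.mul_le_mul_right _ hn
      rw [Nat.succ_mul]; omega
    calc (n * P.Sm (wl x₀ r) + s + 1) * P.Wd (wl x₀ r) ≤ ((u + 1) * P.Sm (wl x₀ r)) * P.Wd (wl x₀ r) :=
        Nat.mul_le_mul_right _ h1
      _ = (u + 1) * (P.Sm (wl x₀ r) * P.Wd (wl x₀ r)) := by ring
      _ ≤ j := huj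
  ext v
  rw [P.mem_trueTabs_iff]
  constructor
  · rintro ⟨n, s, hnu, hn, hs, -, hreal, hans, rfl⟩
    rw [P.blockOf_hist O x₀ r hn hs (hcomp hnu hs) hj] at hreal ⊢
    rw [P.getD_hist_slot_end O x₀ r hn hs (hcomp hnu hs)] at hans
    -- the block is real: it is the padded `s`-th string of stage `n`
    unfold block at hreal hans ⊢
    split_ifs at hreal hans ⊢ with hsl
    · have hlt : ((P.stageList x₀ (P.trueTabs O x₀) n)[s]).length < P.Wd (wl x₀ r) :=
        (P.length_lt_of_mem_stageList (List.getElem_mem hsl)).trans (nq_lt_Wd hP x₀ r)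
      rw [decodePad_padBlock hlt] at hans ⊢
      exact ⟨(Set.mem_iff_boolIndicator _ _).2 hans, n, hnu, List.getElem_mem hsl⟩
    · exact absurd hreal (true_not_mem_replicate _)
  · rintro ⟨hvO, n, hnu, hv⟩
    obtain ⟨s, hsl, rfl⟩ := List.mem_iff_getElem.1 hv
    have hn : n < P.Gm (wl x₀ r) := lt_of_le_of_lt hnu hu
    have hs : s < P.Sm (wl x₀ r) := lt_of_lt_of_le hsl (length_stageList_le_Sm hP x₀ r _ n)
    have hlt : ((P.stageList x₀ (P.trueTabs O x₀) n)[s]).length < P.Wd (wl x₀ r) :=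
      (P.length_lt_of_mem_stageList (List.getElem_mem hsl)).trans (nq_lt_Wd hP x₀ r)
    have hblock : P.block x₀ r (P.trueTabs O x₀) n s = padBlock (P.Wd (wl x₀ r)) ((P.stageList x₀ (P.trueTabs O x₀) n)[s]) := by
      unfold block; rw [dif_pos hsl]
    refine ⟨n, s, hnu, hn, hs, ?_, ?_, ?_, ?_⟩
    · rw [length_hist, Nat.mul_div_right _ two_pos]
      exact hcomp hnu hs
    · rw [P.blockOf_hist O x₀ r hn hs (hcomp hnu hs) hj, hblock]
      exact true_mem_padBlock hW _
    · rw [P.getD_hist_slot_end O x₀ r hn hs (hcomp hnu hs), hblock, decodePad_padBlock hlt]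
      exact (Set.mem_iff_boolIndicator _ _).1 hvO
    · rw [P.blockOf_hist O x₀ r hn hs (hcomp hnu hs) hj, hblock, decodePad_padBlock hlt]

/-- **The advice bit answered along the true history is the bit of the advice stream with the true
tables.** [cite: AaronsonChen2017, §5.3 (pp. 22–23)] -/
theorem advBit_hist (hP : P.IsBounded) (O : Set (List Bool)) (x₀ r : List Bool) {j : ℕ}
    (hj : j < P.advLen (wl x₀ r)) :
    P.advBit x₀ r (P.hist O x₀ r (2 * j)) = P.advAt x₀ r (P.trueTabs O x₀) j := by
  unfold advBit
  rw [length_hist, if_pos (Nat.mul_mod_right 2 j), Nat.mul_div_right _ two_pos]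
  have hSW : 0 < P.Sm (wl x₀ r) * P.Wd (wl x₀ r) := by
    refine Nat.mul_pos ?_ (by unfold Wd; omega)
    unfold Sm; positivity
  by_cases hlearn : j < P.learnLen (wl x₀ r)
  · have hn : j / (P.Sm (wl x₀ r) * P.Wd (wl x₀ r)) < P.Gm (wl x₀ r) :=
      Nat.div_lt_of_lt_mul (by unfold learnLen at hlearn; rwa [mul_comm] at hlearn)
    unfold advAt
    rw [if_pos hlearn, if_pos hlearn, P.block_congr x₀ r (fun u hu => P.tabsOf_hist_eq hP O x₀ r (hu.trans hn)
      ((Nat.mul_le_mul_right _ (Nat.succ_le_of_lt hu)).trans (Nat.div_mul_le_self _ _)) hj.le)]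
  · have hy : P.ySample x₀ r (P.tabsOf x₀ r (P.hist O x₀ r (2 * j))) = P.ySample x₀ r (P.trueTabs O x₀) :=
      P.ySample_congr x₀ r fun u hu =>
        P.tabsOf_hist_eq hP O x₀ r (lt_of_lt_of_le hu (length_gates_le_Gm hP x₀ r))
          (le_trans ((Nat.mul_le_mul_right _ (Nat.succ_le_of_lt (lt_of_lt_of_le hu (length_gates_le_Gm hP x₀ r)))))
            (not_lt.1 hlearn)) hj.le
    unfold advAt
    rw [if_neg hlearn, if_neg hlearn, hy]

/-- **The answers of the adaptive run of the query generator against `TQBF ⊕ O` are the true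
history**, for any `ρ` reducing the advice language to `TQBF`. [cite: AaronsonChen2017, §5.3 (pp. 22–23)] -/
theorem adBits_qSem_eq_hist (hP : P.IsBounded) {ρ : List Bool → List Bool} (hρ : ∀ z, z ∈ P.advLang ↔ ρ z ∈ TQBF)
    (O : Set (List Bool)) (x₀ r : List Bool) :
    ∀ i ≤ 2 * P.advLen (wl x₀ r), AdQuery.adBits (P.qSem ρ) (oracleJoin TQBF O) (boolPair x₀ r) i = P.hist O x₀ r i
  | 0, _ => by simp [hist]
  | i + 1, hi => by
    rw [AdQuery.adBits_succ, adBits_qSem_eq_hist hP hρ O x₀ r i (Nat.le_of_succ_le hi), hist_succ]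
    congr 1
    refine congrArg (fun b => [b]) (Bool.eq_iff_iff.2 ?_)
    rw [← Set.mem_iff_boolIndicator]
    unfold qSem histBit
    simp only [boolUnpair_boolPair, length_hist]
    by_cases hpar : i % 2 = 0
    · rw [if_pos hpar, if_pos hpar]
      refine (false_cons_mem_oracleJoin (A := TQBF) (B := O)).trans ?_
      rw [← hρ]
      have hi2 : P.hist O x₀ r i = P.hist O x₀ r (2 * (i / 2)) := by rw [Nat.mul_div_cancel' (Nat.dvd_of_mod_eq_zero hpar)]
      have key := P.advBit_hist hP O x₀ r (j := i / 2) (by omega)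
      rw [← hi2] at key
      change P.advBit (boolUnpair (boolUnpair (boolPair (boolPair x₀ r) (P.hist O x₀ r i))).1).1
        (boolUnpair (boolUnpair (boolPair (boolPair x₀ r) (P.hist O x₀ r i))).1).2
        (boolUnpair (boolPair (boolPair x₀ r) (P.hist O x₀ r i))).2 = true ↔ _
      simp only [boolUnpair_boolPair]
      rw [key]
    · rw [if_neg hpar, if_neg hpar]
      refine (true_cons_mem_oracleJoin (A := TQBF) (B := O)).trans ?_
      unfold oAns
      rw [← Set.mem_iff_boolIndicator, P.evens_hist O x₀ r (by omega),
        show (i + 1) / 2 = i / 2 + 1 by omega]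
      rfl

/-- **The output of the adaptive transducer `(qSem ρ, rounds, gSem)` against `TQBF ⊕ O` on `⟨x₀, r⟩`
is `post(y)`**, `y` the inverse-CDF sample of the Born law of `V|x₀, 0^m⟩` against the coins `r`.
[cite: AaronsonChen2017, §5.3 (p. 23, "it first takes a sample z … and then outputs A^output(z)")] -/
theorem adFn_qSem_gSem (hP : P.IsBounded) {ρ : List Bool → List Bool} (hρ : ∀ z, z ∈ P.advLang ↔ ρ z ∈ TQBF)
    (O : Set (List Bool)) (x₀ r : List Bool) :
    AdQuery.adFn (P.qSem ρ) P.roundsP P.gSem (oracleJoin TQBF O) (boolPair x₀ r) =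
      P.post (List.ofFn (P.ySample x₀ r (P.trueTabs O x₀))) := by
  rw [AdQuery.adFn_apply, show P.roundsP.eval (boolPair x₀ r).length = 2 * P.advLen (wl x₀ r) by
    rw [eval_roundsP]; rfl, P.adBits_qSem_eq_hist hP hρ O x₀ r _ le_rfl]
  unfold gSem
  simp only [boolUnpair_boolPair]
  rw [P.evens_hist O x₀ r (by omega), show (2 * P.advLen (wl x₀ r) + 1) / 2 = P.advLen (wl x₀ r) by omega,
    List.take_of_length_le (by simp), show (boolPair x₀ r).length = wl x₀ r from rfl,
    P.lastN_advStream_eq_padBlock, decodePad_padBlock (length_post_lt_Wo hP x₀ r (by simp))]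

/-- **With the true tables the sample is the inverse-CDF sample of the Born law of `V|x₀, 0^m⟩`**
(`acSimState`), in numeral order, against the coins `r`. [cite: AaronsonChen2017, §5.3 (p. 23)] -/
theorem ySample_trueTabs (O : Set (List Bool)) (x₀ r : List Bool) :
    P.ySample x₀ r (P.trueTabs O x₀) =
      invCdfVia (qregEquiv (P.nq x₀)) (bornPMF (acSimState P.F O P.c x₀)) r.length (bitsToNat r) := by
  unfold ySample
  rw [P.tabRun_trueTabs_eq_acSimState]

end AcProto

end Literature.Barriers.QuantumAdvantage

end
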